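import Literature.MathematicalPhysics.QuantumFieldTheory.Balaban1983to89.B8Eq178AveragesRec
import Literature.MathematicalPhysics.QuantumFieldTheory.Balaban1983to89.B8Eq1123Concrete

/-!
# `Balaban1983to89.B8Eq1123ConcreteRec` — RECORD TWIN of `B8Eq1123Concrete` §0 ([Balaban1985RegularSpaces] Sect. E pp. 96–97: the remainder `C′_j(u₁, λ)`
# of (1.115) and the functional derivative (1.123)) for the SYMMETRISED CENTRED block averaging (0.4) of [Balaban1987RG1] — the DEFINITIONS

statement-level skeleton of published theorems with citation tags; proofs where landed; nothing here is a claim about the Yang–Mills mass gap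

T. Bałaban, *Spaces of regular gauge field configurations on a lattice and gauge fixing conditions*, Commun. Math. Phys. **99** (1985) 75–102
`[Balaban1985RegularSpaces]` ("[6]"): (1.115) p. 96, (1.123) p. 96; T. Bałaban, *Averaging operations for lattice gauge theories*, Commun. Math. Phys. **98**
(1985) 17–51 `[Balaban1985Averaging]` ("[3]"): (208), (212)–(213) p. 50; T. Bałaban, *Renormalization group approach to lattice gauge field theories. I*,
Commun. Math. Phys. **109** (1987) 249–301 `[Balaban1987RG1]` ("[I]"): (0.3)–(0.4) pp. 252–253, pp. 253–254.  STATUS: published, refereed.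

CITATION HEADER (lean-in-tree rule).  Cell `pub-ymgap`, base `pub-ymgap-dag-n05-c` g26 — N05-REC stage 2 (director-ym №254∕№255), item R5, LEAD PEN dag-n05-e
g35 (inventory `N05-REC-INVENTORY.md` e50db04501ab292d §R5 row `B8Eq1123Concrete`: A `def Cnl, def dCnl, analyticAt_Cnl_family`).  WHAT IS REPRODUCED = the
engine module ✓`B8Eq1123Concrete` (unit `lit-balaban-p05`) §0 under the cell's TOKEN RULE: `Qnl ↦ B8Eq178AveragesRec.QnlZ` (the nonlinear averaging
`log ũ′ʲ` over the centred (0.4) structure), `QprimeIter (zdBlocking d L) (bgT L U₀) ↦ QprimeIter (zdBlockingZ d L) (bgTZ L U₀)` (the generic linear averaging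
(212) of `B7Eq78Linearization` instantiated at the centred blocking with centre-rooted transporters, `B7SectEFLinearisationRec` §9); + the unconditional
`dCnlZ_neg`.  Kind «definition»: `CnlZ`, `dCnlZ` are DEFINITIONS (record twins), `dCnlZ_neg` a theorem; no `instance`, no `notation`, no existing module
modified.  `--supports stmt-QuantumFields-20541` (K0⁷-keyed, COUNT-NEUTRAL).

## WHAT IS CERTIFIED HERE (kernel; axioms `propext` ∕ `Classical.choice` ∕ `Quot.sound`)
* `CnlZ` — `C′_j(u₁, λ)(z) := Q′_j(u₁, λ)(z) − (Q′_jλ)(z)` for the record structure; `dCnlZ` — (1.123) `⟨(δ∕δλ)C′(λ), λ₀⟩ = (d∕dτ) C′(λ + τλ₀)|_{τ=0}`;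
  `dCnlZ_neg` — `⟨δC′(λ), −λ₀⟩ = −⟨δC′(λ), λ₀⟩`.

HONEST SCOPE: two definitions + one line of calculus; the engine's §3–§4 (`analyticAt_Cnl_family`, `hasDerivAt_Cnl_line`, `dCnl_add_smul` — «the analyticity
properties of C′(λ)», resting on [3] (208) `B7Eq208Analytic.analyticAt_Qnl_of207`) are NOT twinned here: their record twins follow the R1 twin of (207)–(208)
(APPEND-ONLY v1.1); §1–§2 of the engine module (`analyticAt_QprimeIter_family`, `QprimeIter_line`, `line_mem_dom207`, …) are generic ∕ structure-free and
REUSED BY NAME.  `HThm4Rec` UNDISCHARGED; caveat (C-S3-1) stands; N05 [B8] DISCHARGED OF RECORD untouched; COUNT 7∕28 (7∕27 excl. NODE O) · K 1∕4 UNMOVED; one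
finite `𝕋⁴` programme at fixed `ε`, Bałaban AS PRINTED; nothing continuum ∕ ℝ⁴ ∕ OS ∕ mass-gap ∕ Clay.  No `sorry`.

[cite: Balaban1985RegularSpaces, (1.115) p.96, (1.123) p.96; Balaban1985Averaging, (208) p.50, (212)–(213) p.50; Balaban1987RG1, (0.3)–(0.4) pp.252–253]
-/

noncomputable section

open NormedSpace Finset

namespace Literature.MathematicalPhysics.QuantumFieldTheory.Balaban1983to89.B8Eq1123ConcreteRec

open B7Prop1Explicit B7Prop2Explicit MatrixLog
open B7Eq78Linearization (QprimeIter)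
open B7SectEFLinearisationRec (zdBlockingZ bgTZ)
open B8Eq178AveragesRec (QnlZ)

-- `Site` alone would resolve to the torus sites of `Setup.lean`; re-export the `ℤ^d` sites of `B7Prop1Explicit`.
export B7Prop1Explicit (Site)

variable {d : ℕ}

/-! ## §0 The objects: `C′_j(u₁, λ)` and the functional derivative (1.123), record structure -/

section Defs

variable {𝔸 : Type*} [NormedRing 𝔸] [NormedAlgebra ℂ 𝔸] [CompleteSpace 𝔸]

/-- **`C′_j(u₁, λ)(z)`, record structure** (twin of `B8Eq1123Concrete.Cnl`) — the remainder of (213) [3], «`Q′(u₁, λ) = Q′λ + C′(λ)`» as used in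
(1.115)–(1.125): the nonlinear averaging `Q′_j(u₁, λ)(z) = log ũ′ʲ(z)` of `u′ = e^{λ}` over the centred (0.4) structure (`B8Eq178AveragesRec.QnlZ`) minus its
linear part `(Q′_jλ)(z)` (`QprimeIter (zdBlockingZ d L) (bgTZ L U₀) j`), at the background `U₀`, level `j`, site `z`.
[cite: Balaban1985RegularSpaces, (1.115) p.96; Balaban1985Averaging, (213) p.50; Balaban1987RG1, (0.4) p.253] -/
def CnlZ (L : ℕ) (U₀ : Site d → Fin d → 𝔸ˣ) (u₁ : Site d → 𝔸ˣ) (j : ℕ) (lam : Site d → 𝔸) (z : Site d) : 𝔸 :=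
  QnlZ L U₀ (fun x => expUnit (lam x)) u₁ j z - QprimeIter (zdBlockingZ d L) (bgTZ L U₀) j lam z

/-- **(1.123) the functional derivative, record structure** (twin of `B8Eq1123Concrete.dCnl`): «`⟨(δ/δλ)C′(λ), λ₀⟩ = (d/dτ) C′(λ + τλ₀)|_{τ=0}`» of
`C′ = C′_j(u₁, ·)` read at the site `z` (`deriv` at `τ = 0` of the complex curve). [cite: Balaban1985RegularSpaces, (1.123) p.96] -/
def dCnlZ (L : ℕ) (U₀ : Site d → Fin d → 𝔸ˣ) (u₁ : Site d → 𝔸ˣ) (j : ℕ) (lam lam₀ : Site d → 𝔸) (z : Site d) : 𝔸 :=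
  deriv (fun τ : ℂ => CnlZ L U₀ u₁ j (lam + τ • lam₀) z) 0

/-- Unfolding `CnlZ`. [cite: Balaban1985RegularSpaces, (1.115) p.96] -/
theorem CnlZ_apply (L : ℕ) (U₀ : Site d → Fin d → 𝔸ˣ) (u₁ : Site d → 𝔸ˣ) (j : ℕ) (lam : Site d → 𝔸) (z : Site d) :
    CnlZ L U₀ u₁ j lam z = QnlZ L U₀ (fun x => expUnit (lam x)) u₁ j z - QprimeIter (zdBlockingZ d L) (bgTZ L U₀) j lam z := rfl

/-- `⟨δC′(λ), −λ₀⟩ = −⟨δC′(λ), λ₀⟩`, record structure (twin of `dCnl_neg`; unconditionally: `τ ↦ C′(λ + τ(−λ₀)) = C′(λ + (−τ)λ₀)`, `deriv_comp_neg`).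
[cite: Balaban1985RegularSpaces, (1.123) p.96] -/
theorem dCnlZ_neg (L : ℕ) (U₀ : Site d → Fin d → 𝔸ˣ) (u₁ : Site d → 𝔸ˣ) (j : ℕ) (lam lam₀ : Site d → 𝔸) (z : Site d) :
    dCnlZ L U₀ u₁ j lam (-lam₀) z = -dCnlZ L U₀ u₁ j lam lam₀ z := by
  unfold dCnlZ
  have h : (fun τ : ℂ => CnlZ L U₀ u₁ j (lam + τ • -lam₀) z) = fun τ : ℂ => CnlZ L U₀ u₁ j (lam + (-τ) • lam₀) z := by
    funext τ; rw [smul_neg, neg_smul]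
  rw [h, deriv_comp_neg (f := fun τ : ℂ => CnlZ L U₀ u₁ j (lam + τ • lam₀) z), neg_zero]

end Defs

end Literature.MathematicalPhysics.QuantumFieldTheory.Balaban1983to89.B8Eq1123ConcreteRec

end
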